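import Summits.Schanuel.Schanuel.Theses.SheetDescent

/-!
# Birth skeleton (BC3) for the crux `SlidingRigidity` (stmt-Schanuel-13674)

Route `route-Schanuel-SheetDescent` (sub-problem `Schanuel`), crux decl
`Summit.Schanuel.Schanuel.Theses.SheetDescent.SlidingRigidity` (rank 2, difficulty open-problem):

  Schanuel in every rank `r < n` ⇒ a ℚ-linearly independent `x ∈ ℂⁿ` with `trdeg ℚ(x, eˣ) < n`
  (a FIRST COUNTEREXAMPLE) admits NO SLIDING sheet deformation `(a, ξ)` inside its ℚ-locus `Λₓ`
  (`(ξ(s) + 2πi a(s), e^{ξ(s)}) ∈ Λₓ` on `(0, ε)`, `(a, ξ)(0⁺) = (0, x)`, `a` real-algebraic, and some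
  `q ∈ ℤⁿ` with `q·ξ` constant but `q·a` not).

THE LINE (= the route's own foreseen glued split `SlidingStructure → RuledLocusRigidity → SlidingRigidity`,
sharpened: the structure step is not "frozen block of corank ≥ 2" but "the witness path is FROZEN OUTRIGHT").
Write `Λ := {q ∈ ℤⁿ : q·ξ constant on (0, ε)}` (saturated, rank `m`, moving rank `r := n − m`), `u₀ := Q_Λ x ∈ ℂᵐ`
(ℚ-linearly independent), `a_u := Q_Λ a` (NON-CONSTANT: the sliding witness `q` lies in `Λ`). In the field `K` of
(germs of) real-analytic functions on `(0, ε)` with `D = d/ds` (constants `ℂ`), the `K`-point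
`P = (ξ + 2πi a, e^ξ)` satisfies `trdeg_ℚ ℚ(P) ≤ d := trdeg ℚ(x, eˣ) ≤ n − 1` (it specialises the generic point
`P₀ = (x, eˣ)` of `Λₓ` — the locus clause), `ℚ(P) ⊇ F₁ := ℚ(u₀ + 2πi a_u, e^{u₀})` (`t₁ := trdeg_ℚ F₁`), and
`ℂ(P) ⊇ ℂ(a_u) ∋^{alg} s` (a non-constant real-algebraic arc), so every `aᵢ`, hence `ξ` and `e^ξ`, is algebraic over
`ℂ(P)` and `trdeg_ℂ ℂ(ξ, e^ξ) ≤ trdeg_ℂ ℂ(P) ≤ 1 + (d − t₁)`. If `r ≥ 1`, Ax 1971 (tree theorem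
`Literature.NumberTheory.Transcendental.ax_schanuel_holds`, one derivation) gives `trdeg_ℂ ℂ(ξ, e^ξ) ≥ r + 1`, so
`t₁ ≤ d − r ≤ m − 1`; letting `s → 0⁺` (`a_u → 0`) the ℚ-ideal of `(u₀ + 2πi a_u, e^{u₀})` specialises into that of
`(u₀, e^{u₀})`, whence `trdeg ℚ(u₀, e^{u₀}) ≤ m − 1 < m` with `u₀ ∈ ℂᵐ` ℚ-independent and `m < n` — contradicting
Schanuel in rank `m`. Hence `r = 0`: EVERY SLIDING DEFORMATION OF A FIRST COUNTEREXAMPLE IS PURE (`ξ ≡ x`), and what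
is left is a statement about the point `x` alone: its locus slice `Λₓ ∩ {Y = eˣ}` is RULED through `x` by the
translate `x + 2πi·b((0, ε))` of a non-constant real-algebraic arc `b` — the Baker-type core.

* STUB A `stub_slidingIsPure` (L — PROVABLE NOW, the MovingDescent twin): Schanuel below `n`, `x` a rank-`n`
  counterexample, `(a, ξ)` a sliding sheet deformation on `(0, ε)` ⇒ `ξ(s) = x` for all `s ∈ (0, ε)`.
  Leans on: `ax_schanuel_holds` (K = germs of real-analytic functions / Laurent series at a point of `(0, ε)`,
  `D = d/ds`, constants `ℂ`), `Algebra.trdeg` additivity in towers, specialisation of prime ideals of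
  `MvPolynomial (Fin n ⊕ Fin n) ℚ`, Smith normal form over `ℤ` for `Λ` (`Matrix`/`Submodule` of `Fin n → ℤ`).
  Why it might fail: only through slack in the inlined arc conditions — checked: analyticity on `(0, ε)` makes the
  function ring a domain, one-sided continuity at `0` pins every frozen combination to its value at `x` and sends
  `a_u → 0`, coordinatewise real-algebraicity of `a` gives `trdeg_ℂ ℂ(a) ≤ 1`; the margin is zero (`r + 1` vs `r`),
  exactly as in MovingDescent (stmt-Schanuel-13676).
* STUB B `stub_pureArcCostsOneDegree` (M — PROVABLE NOW, hypothesis-free structure): a pure sliding arc of ANY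
  `x ∈ ℂⁿ` costs one transcendence degree: `trdeg ℚ(eˣ) + 1 ≤ trdeg ℚ(x, eˣ)` (`ℚ(x + 2πi b, eˣ) ⊆ K` has
  `trdeg_ℚ ≤ d`, contains the constants `ℚ(eˣ)` of trdeg `t₀`, and `ℂ(x + 2πi b, eˣ) = ℂ(b)` has `trdeg_ℂ = 1`
  because `b ≢ 0`, `b(0⁺) = 0` makes some `bᵢ` non-constant; so `1 ≤ d − t₀`). For a first counterexample
  (`d ≤ n − 1`) this is the crux docstring's "trdeg ℚ(eˣ) ≤ n − 2"; at `n = 2` it puts `eˣ ∈ ℚ̄²` (first step of the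
  support item SlidingTwoUnimodular, stmt-Schanuel-13677).
* STUB C `stub_ruledLocusRigidity` (OPEN — LOAD-BEARING, the Baker-type core = the route's `RuledLocusRigidity`):
  Schanuel below `n`, `x ∈ ℂⁿ` ℚ-independent with `trdeg ℚ(x, eˣ) < n` and `trdeg ℚ(eˣ) + 2 ≤ n` ⇒ `x` admits NO
  pure sliding arc: no non-constant real-algebraic `b` on `(0, ε)`, `b(0⁺) = 0`, with `(x + 2πi b(s), eˣ) ∈ Λₓ`.
  Geometric reading: the real-algebraic set `Rₓ := {b ∈ ℝⁿ : (x + 2πi b, eˣ) ∈ Λₓ}` has `0` as an ISOLATED point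
  (curve selection + Puiseux parametrisation turn a positive-dimensional germ of `Rₓ` at `0` into such an arc).
  At `n = 2` it is, by SlidingTwoUnimodular and the refuter's analysis (evidence ANALYSIS.md on the item),
  EQUIVALENT to "two ℚ-independent arguments of unimodular algebraic numbers are algebraically independent"; the
  refuter's kernel-checked HARDNESS INSTANCE `SR → Transcendental ℚ (cexp (π² · I))` (`x = (iπ, iπ²)` sliding along
  `X₂ = −i X₁²` with `b(s) = (s, 2π(s + s²))`) is a PURE arc, so it certifies STUB C — not A or B — as
  open-problem-hard, as intended: the line quarantines the arithmetic in C and makes A, B landable now.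
  Why it might fail: it cannot be refuted without refuting Schanuel (Schanuel ⇒ no first counterexample); it can
  stall: Baker (`baker_holds`) kills only LINE-shaped `Rₓ` (linear forms in logarithms), nothing known handles
  ℚ̄-curves of degree ≥ 2 (barrier `Literature.Barriers.Schanuel.AlgebraicIndependenceOfLogarithms`, declared
  not evaded by the route; `LinearSubgroupMethodLimit`).

Composition (kernel-checked, no `sorry` outside the stubs): `SlidingRigidity_of : stub_A → stub_B → stub_C →
SlidingRigidity` (hypotheses typed by the name-keyed aliases `__Registered.stub_*`, device of
`Summits/CriticalPhenomena/PercolationContinuityZ3/Cruxes/StrictPlugSieve/Lines/birth.lean`). Proof: a sliding deformation `(a, ξ, ε)` of a first counterexample has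
`ξ ≡ x` on `(0, ε)` (A); then `a` itself is a pure sliding arc (`q·a` non-constant forces `a ≢ 0`; the locus clause
rewrites along `ξ(s) = x`) — plumbing lemma `isPureSlidingArc_of_frozen`, proved; B and `trdeg ℚ(x, eˣ) < n` give
`trdeg ℚ(eˣ) + 2 ≤ n` (cardinal arithmetic `T + 1 ≤ D < n`); C closes. ALL THREE STUBS ARE LOAD-BEARING (drop A:
nothing freezes `ξ`; drop B: C's degeneracy hypothesis is unavailable; drop C: the pure arcs are exactly what is
left). None is the crux or the summit in costume: A and B are CONSEQUENCES of a deformation (provable), C is the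
crux restricted to frozen witnesses under an extra degeneracy hypothesis (BC3 probes `stub → SlidingRigidity`,
`stub → Schanuel` by `first | exact? | simpa | aesop` all FAIL — planner folder `bc/probes.lean`).

DISPROOF USED: none exists (`ledger crux ls stmt-Schanuel-13674`: no workfiles, no `Disproof.lean`, no landed
`Theorems/SlidingRigidity/Negative/*`, 2026-08-17). Negatives index of the summit: 2 refuted statements
(PolarPhantoms 6844/6846, "trdeg < n for every nonzero α"), unrelated to deformations. Refuter crux-attack
(Evidence0.lean, 2026-08-15): SR survives; Schanuel → SR; ranks `n ≤ 1` vacuous (Hermite–Lindemann); the `¬∃`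
block is inhabited once a hypothesis is dropped (`x = 2πi`; `x = (2πi, 2πi)`) — witnesses that are necessarily
PURE arcs (`e^{ξ} ≡ 1` pins `ξ`), consistent with STUB A. Degenerate instances: `n = 0` (no `b s ≠ 0` in `Fin 0 → ℝ`: STUB B/C vacuous,
crux vacuous as `trdeg < 0` is false); `n = 1` (hypotheses contradictory by Hermite–Lindemann).
-/

noncomputable section

set_option linter.dupNamespace false

open scoped BigOperators

namespace Summit.Schanuel.Schanuel.Cruxes.SlidingRigidity.Birth

open Summit.Schanuel.Schanuel.Theses.SheetDescent (SlidingRigidity)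

/-! ## Vocabulary of the line — VERBATIM sub-blocks of the crux -/

/-- Schanuel's conjecture in every rank `r < n` (verbatim the crux's first hypothesis). -/
def SchanuelBelow (n : ℕ) : Prop :=
  ∀ r < n, ∀ y : Fin r → ℂ, LinearIndependent ℚ y →
    (r : Cardinal) ≤ Algebra.trdeg ℚ ↥(IntermediateField.adjoin ℚ (Set.range y ∪ Set.range (Complex.exp ∘ y)))

/-- A SHEET DEFORMATION `(a, ξ)` of `x` on `(0, ε)` — verbatim the crux's arc block: `ε > 0`, `(a, ξ)(0) = (0, x)`,
one-sided continuity at `0`, real-analyticity on `(0, ε)`, the sheet path `a` coordinatewise real-algebraic in `s`,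
and the points `(ξ(s) + 2πi a(s), e^{ξ(s)})` in the ℚ-locus of `(x, eˣ)` (every ℚ-polynomial relation of `(x, eˣ)`
persists). -/
def IsSheetDeformation (n : ℕ) (x : Fin n → ℂ) (a : ℝ → Fin n → ℝ) (ξ : ℝ → Fin n → ℂ) (ε : ℝ) : Prop :=
  0 < ε ∧ a 0 = 0 ∧ ξ 0 = x ∧ ContinuousWithinAt a (Set.Ici 0) 0 ∧ ContinuousWithinAt ξ (Set.Ici 0) 0 ∧
    AnalyticOnNhd ℝ a (Set.Ioo 0 ε) ∧ AnalyticOnNhd ℝ ξ (Set.Ioo 0 ε) ∧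
    (∀ i, ∃ p : MvPolynomial (Fin 2) ℝ, p ≠ 0 ∧ ∀ s ∈ Set.Ioo 0 ε, MvPolynomial.eval ![s, a s i] p = 0) ∧
    (∀ s ∈ Set.Ioo 0 ε, ∀ f : MvPolynomial (Fin n ⊕ Fin n) ℚ,
      MvPolynomial.aeval (Sum.elim x (Complex.exp ∘ x)) f = 0 →
        MvPolynomial.aeval (Sum.elim (fun i => ξ s i + 2 * (Real.pi : ℂ) * Complex.I * ((a s i : ℝ) : ℂ))
          (fun i => Complex.exp (ξ s i))) f = 0)

/-- The deformation is SLIDING (verbatim the crux's last block): some `ℤ`-combination `q·ξ` is constant on `(0, ε)`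
while `q·a` is not. -/
def IsSliding (n : ℕ) (a : ℝ → Fin n → ℝ) (ξ : ℝ → Fin n → ℂ) (ε : ℝ) : Prop :=
  ∃ q : Fin n → ℤ, (∃ c : ℂ, ∀ s ∈ Set.Ioo 0 ε, ∑ i, (q i : ℂ) * ξ s i = c) ∧
    ¬ (∃ c : ℝ, ∀ s ∈ Set.Ioo 0 ε, ∑ i, (q i : ℝ) * a s i = c)

/-- A PURE SLIDING ARC `b` of `x` on `(0, ε)`: the witness path FROZEN at `x`, the sheet path `b` real-algebraic,
`b(0⁺) = 0`, the points `(x + 2πi b(s), eˣ)` in the ℚ-locus of `(x, eˣ)`, and `b ≢ 0` on `(0, ε)` — the locus slice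
`Λₓ ∩ {Y = eˣ}` is ruled through `x` by the translate `x + 2πi·b((0, ε))` of a real-algebraic arc. -/
def IsPureSlidingArc (n : ℕ) (x : Fin n → ℂ) (b : ℝ → Fin n → ℝ) (ε : ℝ) : Prop :=
  0 < ε ∧ b 0 = 0 ∧ ContinuousWithinAt b (Set.Ici 0) 0 ∧ AnalyticOnNhd ℝ b (Set.Ioo 0 ε) ∧
    (∀ i, ∃ p : MvPolynomial (Fin 2) ℝ, p ≠ 0 ∧ ∀ s ∈ Set.Ioo 0 ε, MvPolynomial.eval ![s, b s i] p = 0) ∧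
    (∀ s ∈ Set.Ioo 0 ε, ∀ f : MvPolynomial (Fin n ⊕ Fin n) ℚ,
      MvPolynomial.aeval (Sum.elim x (Complex.exp ∘ x)) f = 0 →
        MvPolynomial.aeval (Sum.elim (fun i => x i + 2 * (Real.pi : ℂ) * Complex.I * ((b s i : ℝ) : ℂ))
          (Complex.exp ∘ x)) f = 0) ∧
    (∃ s ∈ Set.Ioo 0 ε, b s ≠ 0)

/-- The crux, literally, in the line's vocabulary. -/
theorem slidingRigidity_iff :
    SlidingRigidity ↔
      ∀ n : ℕ, SchanuelBelow n → ∀ x : Fin n → ℂ, LinearIndependent ℚ x →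
        Algebra.trdeg ℚ ↥(IntermediateField.adjoin ℚ (Set.range x ∪ Set.range (Complex.exp ∘ x))) < (n : Cardinal) →
          ¬ ∃ (a : ℝ → Fin n → ℝ) (ξ : ℝ → Fin n → ℂ) (ε : ℝ), IsSheetDeformation n x a ξ ε ∧ IsSliding n a ξ ε :=
  Iff.rfl

/-! ## The three stub statements -/

/-- STUB A statement: every sliding deformation of a first counterexample is PURE — the witness path is frozen at
`x` on `(0, ε)` (moving rank `r = 0`; `r ≥ 1` is expelled by Ax on the moving block + Schanuel in rank `n − r`). -/
def SlidingIsPure : Prop :=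
  ∀ n : ℕ, SchanuelBelow n → ∀ x : Fin n → ℂ, LinearIndependent ℚ x →
    Algebra.trdeg ℚ ↥(IntermediateField.adjoin ℚ (Set.range x ∪ Set.range (Complex.exp ∘ x))) < (n : Cardinal) →
      ∀ (a : ℝ → Fin n → ℝ) (ξ : ℝ → Fin n → ℂ) (ε : ℝ), IsSheetDeformation n x a ξ ε → IsSliding n a ξ ε →
        ∀ s ∈ Set.Ioo 0 ε, ξ s = x

/-- STUB B statement: a pure sliding arc costs one transcendence degree — `trdeg ℚ(eˣ) + 1 ≤ trdeg ℚ(x, eˣ)`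
(no Schanuel, no independence, no counterexample hypothesis). -/
def PureArcCostsOneDegree : Prop :=
  ∀ (n : ℕ) (x : Fin n → ℂ) (b : ℝ → Fin n → ℝ) (ε : ℝ), IsPureSlidingArc n x b ε →
    Algebra.trdeg ℚ ↥(IntermediateField.adjoin ℚ (Set.range (Complex.exp ∘ x))) + 1 ≤
      Algebra.trdeg ℚ ↥(IntermediateField.adjoin ℚ (Set.range x ∪ Set.range (Complex.exp ∘ x)))

/-- STUB C statement (the Baker-type core, `RuledLocusRigidity`): a first counterexample whose exponentials are
degenerate (`trdeg ℚ(eˣ) + 2 ≤ n`) admits no pure sliding arc — its locus slice at `Y = eˣ` is not ruled through `x`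
by a translate of a real-algebraic arc in the direction `iℝⁿ`. -/
def RuledLocusRigidity : Prop :=
  ∀ n : ℕ, SchanuelBelow n → ∀ x : Fin n → ℂ, LinearIndependent ℚ x →
    Algebra.trdeg ℚ ↥(IntermediateField.adjoin ℚ (Set.range x ∪ Set.range (Complex.exp ∘ x))) < (n : Cardinal) →
      Algebra.trdeg ℚ ↥(IntermediateField.adjoin ℚ (Set.range (Complex.exp ∘ x))) + 2 ≤ (n : Cardinal) →
        ¬ ∃ (b : ℝ → Fin n → ℝ) (ε : ℝ), IsPureSlidingArc n x b ε

/-! ## Registered stubs -/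

/-- **STUB A `slidingIsPure`** (L, PROVABLE NOW). Ax 1971 Thm 3 with one derivation on the moving block `v`
(`trdeg_ℂ ℂ(v, e^v) ≥ r + 1`) against the specialisation count `trdeg_ℂ ℂ(ξ, e^ξ) ≤ 1 + d − t₁`, then Schanuel in
rank `m = n − r < n` on the frozen block `u₀ = Q_Λ x` (its ideal is the `s → 0⁺` specialisation of that of
`(u₀ + 2πi a_u, e^{u₀})`, of trdeg `t₁ ≤ m − 1`). So `r = 0`, every `ξᵢ` is constant on `(0, ε)`, `= xᵢ` by
one-sided continuity at `0`.
Sources: Ax1971 (Thm 3, Cor 1), Kirby2010EAEF (Prop 7.2, nearest printed shape), Lang1966; tree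
`Literature.NumberTheory.Transcendental.ax_schanuel_holds`. -/
theorem stub_slidingIsPure : SlidingIsPure := by
  sorry

/-- **STUB B `pureArcCostsOneDegree`** (M, PROVABLE NOW). `L := ℚ(x + 2πi b, eˣ) ⊆ K` (functions on `(0, ε)`):
`trdeg_ℚ L ≤ trdeg ℚ(x, eˣ)` (the locus clause: the ℚ-ideal of `(x, eˣ)` is contained in that of the `K`-point),
`ℚ(eˣ) ⊆ L ∩ ℂ`, and `ℂL = ℂ(b)` has `trdeg_ℂ ℂ(b) = 1` (`≤ 1`: each `bᵢ` algebraic over `ℝ(s)`; `≥ 1`: some `bᵢ`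
is a non-constant continuous function, hence transcendental over `ℂ`). Additivity of `Algebra.trdeg` in the tower
`ℚ ⊆ ℚ(eˣ) ⊆ L` and base change to `ℂ`.
Sources: Lang1966 (Ch. III specialisations), Ax1971; Mathlib `Algebra.trdeg`, `IntermediateField.adjoin`. -/
theorem stub_pureArcCostsOneDegree : PureArcCostsOneDegree := by
  sorry

/-- **STUB C `ruledLocusRigidity`** (OPEN — LOAD-BEARING; the arithmetic core). At `n = 2`: two ℚ-independent
arguments of unimodular algebraic numbers on a real trace of a ℚ̄-curve (⟺ their algebraic independence; LINE traces
die by `baker_holds`, curved ones are open — contains `e^{iπ²} ∉ ℚ̄`). General `n`: `0` is isolated in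
`Rₓ = {b ∈ ℝⁿ : (x + 2πi b, eˣ) ∈ Λₓ}` for every first counterexample `x` with `trdeg ℚ(eˣ) ≤ n − 2`.
Sources: BakerTNT1975, Waldschmidt2000 (Conj. 1.15-type), DaquinoMacintyreTerzo2014, Zilber2002; tree
`Literature.NumberTheory.Transcendental.baker_holds`, `transcendental_exp_holds`; barrier
`Literature.Barriers.Schanuel.AlgebraicIndependenceOfLogarithms` (applies, not evaded). -/
theorem stub_ruledLocusRigidity : RuledLocusRigidity := by
  sorry

/-! ### Name-keyed aliases of the stub statements
`__Registered.stub_X` is statement `X` under the registered stub's short name, so that the native skeleton audit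
(`#h21_check_skeleton`: hypotheses admissible iff registered obligations / declared stubs BY NAME) accepts
`SlidingRigidity_of : __Registered.stub_… → … → SlidingRigidity` (device of the CriticalPhenomena `StrictPlugSieve` birth file). -/
namespace __Registered

/-- Alias of `SlidingIsPure` keyed by the registered stub name. -/
abbrev stub_slidingIsPure : Prop := SlidingIsPure
/-- Alias of `PureArcCostsOneDegree` keyed by the registered stub name. -/
abbrev stub_pureArcCostsOneDegree : Prop := PureArcCostsOneDegree
/-- Alias of `RuledLocusRigidity` keyed by the registered stub name. -/
abbrev stub_ruledLocusRigidity : Prop := RuledLocusRigidity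

end __Registered

/-! ## Proved plumbing -/

/-- A sliding deformation whose witness path is frozen at `x` IS a pure sliding arc (sheet path `a` itself):
the locus clause rewrites along `ξ(s) = x`, and `q·a` non-constant forces `a ≢ 0` on `(0, ε)`. -/
theorem isPureSlidingArc_of_frozen {n : ℕ} {x : Fin n → ℂ} {a : ℝ → Fin n → ℝ} {ξ : ℝ → Fin n → ℂ} {ε : ℝ}
    (hdef : IsSheetDeformation n x a ξ ε) (hsl : IsSliding n a ξ ε) (hfrozen : ∀ s ∈ Set.Ioo 0 ε, ξ s = x) :
    IsPureSlidingArc n x a ε := by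
  obtain ⟨hε, ha0, -, hca, -, haa, -, halg, hloc⟩ := hdef
  refine ⟨hε, ha0, hca, haa, halg, ?_, ?_⟩
  · intro s hs f hf
    have h := hloc s hs f hf
    rw [hfrozen s hs] at h
    exact h
  · by_contra hnone
    push Not at hnone
    obtain ⟨q, -, hqa⟩ := hsl
    exact hqa ⟨0, fun s hs => by simp [hnone s hs]⟩

/-- Cardinal bookkeeping: `T + 1 ≤ D` and `D < n` give `T + 2 ≤ n`. -/
theorem add_two_le_of_add_one_le_of_lt {T D : Cardinal} {n : ℕ} (h1 : T + 1 ≤ D) (h2 : D < (n : Cardinal)) :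
    T + 2 ≤ (n : Cardinal) := by
  have h3 : D + 1 ≤ (n : Cardinal) := Cardinal.add_one_le_of_lt h2
  calc T + 2 = T + 1 + 1 := by rw [add_assoc, one_add_one_eq_two]
    _ ≤ D + 1 := by gcongr
    _ ≤ (n : Cardinal) := h3

/-! ## The composition, by name -/

/-- **`SlidingRigidity_of`**: the three registered stubs imply the crux
`Summit.Schanuel.Schanuel.Theses.SheetDescent.SlidingRigidity` (kernel-checked; no `sorry` outside the stubs). -/
theorem SlidingRigidity_of (hA : __Registered.stub_slidingIsPure) (hB : __Registered.stub_pureArcCostsOneDegree)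
    (hC : __Registered.stub_ruledLocusRigidity) :
    Summit.Schanuel.Schanuel.Theses.SheetDescent.SlidingRigidity := by
  rw [slidingRigidity_iff]
  rintro n hS x hx hd ⟨a, ξ, ε, hdef, hsl⟩
  -- STUB A: the witness path is frozen at `x` on `(0, ε)`
  have hfrozen : ∀ s ∈ Set.Ioo 0 ε, ξ s = x := hA n hS x hx hd a ξ ε hdef hsl
  -- so the sheet path `a` is a pure sliding arc of `x`
  have harc : IsPureSlidingArc n x a ε := isPureSlidingArc_of_frozen hdef hsl hfrozen
  -- STUB B: `trdeg ℚ(eˣ) + 1 ≤ trdeg ℚ(x, eˣ) < n`, hence `trdeg ℚ(eˣ) + 2 ≤ n`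
  have hdeg : Algebra.trdeg ℚ ↥(IntermediateField.adjoin ℚ (Set.range (Complex.exp ∘ x))) + 2 ≤ (n : Cardinal) :=
    add_two_le_of_add_one_le_of_lt (hB n x a ε harc) hd
  -- STUB C: no pure sliding arc
  exact hC n hS x hx hd hdeg ⟨a, ε, harc⟩

/-- Wiring check: the registered stubs feed `SlidingRigidity_of` as stated. -/
example : Summit.Schanuel.Schanuel.Theses.SheetDescent.SlidingRigidity :=
  SlidingRigidity_of stub_slidingIsPure stub_pureArcCostsOneDegree stub_ruledLocusRigidity

end Summit.Schanuel.Schanuel.Cruxes.SlidingRigidity.Birth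

end
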